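import Literature.Analysis.FluidPDE.AxisymSmallSwirlL4
import Literature.Analysis.FluidPDE.GeneralizedAxisymNS
import Literature.Analysis.FluidPDE.SelfSimilarCollapseAnsatz
import HarnessLib

/-!
# Luo–Hou 2014: the boundary blow-up scenario of the axisymmetric Euler equations — the printed
# datum, its printed structural properties (proved), and the printed fitted exponents (data)

G. Luo, T. Y. Hou, *Toward the finite-time blowup of the 3D axisymmetric Euler equations: a numerical
investigation*, Multiscale Model. Simul. **12** (2014) 1722–1776 [LuoHou2014] = arXiv:1310.0497 (the long
text; `p.`/`L` below = chunk/line of the held arXiv rendering `paper:arxiv-1310.0497`), and the summary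
G. Luo, T. Y. Hou, *Potentially singular solutions of the 3D axisymmetric Euler equations*, PNAS **111**
(2014) 12968–12973 [LuoHou2014PNAS].

HONEST FRAMING (cell ns-blowup, profile zone Z8 «Hou–Luo corner analogue WITHOUT boundary» and Z3-b′;
human rulings D-0035/D-0081). **NUMERICS for 3D axisymmetric EULER WITH A SOLID WALL — not a theorem, not
Navier–Stokes.** Nothing in this file asserts that any Euler or Navier–Stokes solution blows up. What IS a
theorem in print for this scenario is Chen–Hou 2022/2023 (`ChenHou2022_axisymmetricEulerBlowup`,
`ChenHouBlowup.lean`) for a DIFFERENT smooth datum close to a computer-assisted approximate profile; the 1-D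
wall model is `HouLuoModelSelfSimilarBlowup.lean` (CHH 2022, HQWW 2025).

## What is printed

§2 (p0005): the axisymmetric Euler equations in the Hou–Li variables `u₁ = u^θ/r`, `ω₁ = ω^θ/r`,
`ψ₁ = ψ^θ/r` (the tree's `GeneralizedAxisymNS` at `n = 3`, `ν = 0`):
`u₁,t + uʳu₁,r + uᶻu₁,z = 2u₁ψ₁,z`, `ω₁,t + uʳω₁,r + uᶻω₁,z = (u₁²)_z`,
`−[∂ᵣ² + (3/r)∂ᵣ + ∂_z²]ψ₁ = ω₁`, `uʳ = −rψ₁,z`, `uᶻ = 2ψ₁ + rψ₁,r`, solved "on the cylinder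
`D(1, L) = {(r,z) : 0 ≤ r ≤ 1, 0 ≤ z ≤ L}` with the initial data

> `u₁⁰(r,z) = 100 e^{−30(1−r²)⁴} sin(2πz/L)`, `ω₁⁰(r,z) = ψ₁⁰(r,z) = 0` (eq. (eqn_eat_ic), p0005 L82)

… subject to a periodic boundary condition in `z` … and a no-flow boundary condition on the solid
boundary `r = 1`: `ψ₁(1,z,t) = 0`" and the pole condition `u₁,r = ω₁,r = ψ₁,r = 0` at `r = 0`;
"`L = 1/6`" (§4, p0009 L3); "`u₁⁰` is even at `z = L/4, 3L/4`, odd at `z = 0, L/2`" (p0005 L109), so the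
quarter cylinder `D(1, L/4)` has impermeable walls.

§4 (NUMERICS, recorded as data below): meshes `256k × 256k`, `k = 4,…,8`, effective resolution
`(3 × 10¹²)²` (abstract p0002); predicted singularity time `t_s ≈ 0.0035056` with a `3 × 10⁸`-fold growth
of `‖ω‖_∞` (p0002, §4.4 p0015 L47); the singularity sits ON THE WALL at the ring `q̃₀ = (r,z) = (1,0)`, a
stagnation point of the wall compression flow `uᶻ = ψ₁,r ≤ 0` on `r = 1` (§4.8 p0022); fits
`‖ω(·,t)‖_∞ ∼ c₁(t_s − t)^{−2.4568}` (p0018 L72), `d₁(D_∞(t)) ∼ [δ⁻¹(t̂_s − t)]^{2.9181}` for the diameter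
of the region of near-maximal vorticity (p0018 L75), `‖∇u‖_∞ = O(T−t)^{−2.4529}` (p0021 L75); the
meridian-plane self-similar ansatz `u₁ ∼ (t_s−t)^{γ_u}U((x̃−q̃₀)/(t_s−t)^{γ_l})` etc. with the dominant
balance "`γ_u = −1 + γ_l/2`, `γ_ω = −1`, `γ_ψ = −1 + 2γ_l`" (eq. (eqn_ssim_constr), p0022 L43) and
"`ωʳ = −ru₁,z = O(t_s−t)^{−2.45}`, `ω^θ = rω₁ = O(t_s−t)^{−1}`, `ωᶻ = O(t_s−t)^{−2.45}`" (p0022 L54), i.e.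
`γ_l ≈ 2.9` (Chen–Hou–Huang 2022 quote the Luo–Hou value `λ ≈ 2.9215`; Chen–Hou Part I §3 report their own
`c̄_l/|c̄_ω| ≈ 2.92056` as "very close to the one reported by Hou–Luo": `chenHou_collapseExponent`).
§5 (p0024 L40): the 1-D wall model on `[0, L]` with `v_z = Hω` and datum `u⁰(z) = 10⁴ sin²(2πz/L)`,
`ω⁰ = 0`, under the identification `u(z) ∼ u₁²(1,z)`.
§4.8 (p0022 L60–L67, the printed MECHANISM HYPOTHESIS): "the initial angular velocity `ru₁⁰` is
monotonically increasing in both `r` and `z` within the quarter cylinder `D(1, L/4)` … As long as `ru₁⁰`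
has the desired symmetry properties and is monotonically increasing in both `r` and `z` in the quarter
cylinder, the solution … should develop a singularity in finite-time, in much the same way."

## Contents (namespace `Literature.Analysis.FluidPDE.LuoHou2014`)

* DATA (defs with bodies): `periodL = 1/6`, `initialU1 r z`, `swirlProfile`, `initialVelocity`
  (`= u₁⁰ · (−x₁, x₀, 0) = r u₁⁰ e_θ`, pure swirl), `wallModelInitialU z = 10⁴ sin²(2πz/L)`; printed
  numerics `singularityTime`, `vorticityAmplification`, `vorticityExponent = 2.4568`,
  `diameterExponent = 2.9181`, `gradUExponent = 2.4529`, and the exponent bookkeeping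
  `MeridianExponents` of (eqn_ssim_constr).
* PROVED: `u₁⁰` odd and `L`-periodic in `z`, odd about `z = L/2`, even about `z = L/4`, even in `r`,
  `|u₁⁰| ≤ 100`, smooth, and — unlike Hou's 2021/2022 interior datum `Hou2022.initialU1` — NOT vanishing at
  the wall: `u₁⁰(1,z) = 100 sin(2πz/L)` (the radial factor is maximal AT `r = 1`; Euler allows slip);
  `(u₁⁰(1,z))² = wallModelInitialU z` (the printed identification `u ∼ u₁²(1,·)` holds exactly at `t = 0`);
  the monotonicity hypothesis of §4.8 for this datum (`ru₁⁰` monotone in `r ∈ [0,1]` and in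
  `z ∈ [0, L/4]`); the 3-D datum is smooth, axisymmetric, divergence free, has no poloidal part, swirl
  `Γ₀ = r²u₁⁰` with `|Γ₀| ≤ 100` in the pipe, satisfies the no-flow condition `u₀ · x' = 0`, and equals
  `GeneralizedAxisymNS.toVelocity u₁⁰ 0`.
* EXPONENT ARITHMETIC (kernel facts about printed numbers): from (eqn_ssim_constr) the radial/axial
  vorticity exponent is `γ_u − γ_l = −(1 + γ_l/2)`, so the printed `2.4568` reads `γ_l = 2.9136`
  (`collapseExponentOfVorticityFit`), within `5·10⁻³` of the printed diameter fit `2.9181` and within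
  `10⁻²` of Chen–Hou's `2.92056`; both exceed `½`, hence along such a collapse a CONSTANT viscosity has
  effective size `ν(T−t)^{1−2γ} → +∞` (`tendsto_effectiveViscosity_luoHou2014_atTop`: the census hook of
  `SelfSimilarCollapseAnsatz.lean`, SELFSIM-NOGO (M8)) — viscosity is not perturbative on this scenario,
  the arithmetic behind "Z8 stage 2".

WHAT THIS IS NOT: not NS; not a blow-up theorem; the exponents are least-squares fits printed by the
source ("line fitting", §4.4–4.7 of the arXiv text), recorded as real numbers. Section numbers are those
of the arXiv rendering (§4.4 maximum vorticity, §4.6 vorticity directions, §4.7 locally self-similar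
structure, §4.8 understanding the blowup, §5 conclusion).
-/

noncomputable section

open Set Function Real InnerProductSpace Filter Topology
open scoped ContDiff RealInnerProductSpace

namespace Literature.Analysis.FluidPDE

namespace LuoHou2014

/-! ### The printed data -/

/-- **The axial period `L = 1/6`** ("on the quarter cylinder `D(1, L/24)` (with `L = 1/6`)", §4).
[cite: LuoHou2014, §4 (arXiv:1310.0497 p0009 L3)] -/
def periodL : ℝ := 1 / 6

/-- `L > 0`. [cite: LuoHou2014, §4 (L = 1/6)] -/
theorem periodL_pos : 0 < periodL := by norm_num [periodL]

/-- **The Luo–Hou initial angular velocity profile** `u₁⁰(r,z) = 100 e^{−30(1−r²)⁴} sin(2πz/L)` in the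
Hou–Li variable `u₁ = u^θ/r`; `ω₁⁰ = ψ₁⁰ = 0`. A function of `(r,z) ∈ ℝ²`; the flow lives on
`0 ≤ r ≤ 1`, `z ∈ ℝ/Lℤ`. [cite: LuoHou2014, §2 eq. (eqn_eat_ic) (arXiv:1310.0497 p0005 L82)] -/
def initialU1 (r z : ℝ) : ℝ :=
  100 * Real.exp (-30 * (1 - r ^ 2) ^ 4) * Real.sin (2 * π * z / periodL)

/-- **The datum of the 1-D wall model** (§5): `u⁰(z) = 10⁴ sin²(2πz/L)`, `ω⁰(z) = 0`, for the model
`u_t + vu_z = 0`, `ω_t + vω_z = u_z`, `v_z = Hω` on `(0, L)` under the identification `u(z) ∼ u₁²(1,z)`,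
`ω ∼ ω₁(1,z)`, `v ∼ ψ₁,r(1,z)`. [cite: LuoHou2014, §5 (arXiv:1310.0497 p0024 L40)] -/
def wallModelInitialU (z : ℝ) : ℝ := 10 ^ 4 * Real.sin (2 * π * z / periodL) ^ 2

/-- **Predicted singularity time** "`t_s ≈ 0.0035056`". Printed numerical estimate (line fitting, §4.4).
[cite: LuoHou2014, abstract and §4.4 (arXiv:1310.0497 p0002, p0015 L47)] -/
def singularityTime : ℝ := 0.0035056

/-- **Vorticity amplification** "a `(3 × 10⁸)`-fold increase in the maximum vorticity". Printed number.
[cite: LuoHou2014, abstract (arXiv:1310.0497 p0002)] -/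
def vorticityAmplification : ℝ := 3e8

/-- **Effective resolution** "a maximum effective resolution of over `(3 × 10¹²)²` near the point of the
singularity" (per direction: `3 × 10¹²`). Printed number. [cite: LuoHou2014, abstract (arXiv:1310.0497 p0002)] -/
def effectiveResolutionPerDirection : ℝ := 3e12

/-- **Fitted vorticity exponent** "`‖ω(·,t)‖_∞ ∼ c₁(t_s − t)^{−2.4568}`, `c₁ = 7.3273 × 10⁻⁴`". Printed fit.
[cite: LuoHou2014, §4.6 (arXiv:1310.0497 p0018 L72)] -/
def vorticityExponent : ℝ := 2.4568

/-- **Fitted collapse (diameter) exponent** "`d₁(D_∞(t)) ∼ [δ⁻¹(t̂_s − t)]^{2.9181}`, `δ = 7.0214 × 10⁻³`"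
(`D_∞(t)` = the region where `|ω| ≥ ½‖ω‖_∞`). Printed fit of a physical length scale.
[cite: LuoHou2014, §4.6 (arXiv:1310.0497 p0018 L75)] -/
def diameterExponent : ℝ := 2.9181

/-- **Fitted velocity-gradient exponent** "`‖∇u(·,t)‖_∞ = O(T−t)^{−2.4529}`". Printed fit.
[cite: LuoHou2014, §4.7 (arXiv:1310.0497 p0021 L75)] -/
def gradUExponent : ℝ := 2.4529

/-! ### Printed structural properties of `u₁⁰` -/

/-- The radial factor `e^{−30(1−r²)⁴}` is at most `1`. [cite: LuoHou2014, §2 eq. (eqn_eat_ic)] -/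
theorem radialFactor_le_one (r : ℝ) : Real.exp (-30 * (1 - r ^ 2) ^ 4) ≤ 1 := by
  rw [Real.exp_le_one_iff]
  have : 0 ≤ (1 - r ^ 2) ^ 4 := by positivity
  linarith

/-- The radial factor is positive. [cite: LuoHou2014, §2 eq. (eqn_eat_ic)] -/
theorem radialFactor_pos (r : ℝ) : 0 < Real.exp (-30 * (1 - r ^ 2) ^ 4) := Real.exp_pos _

/-- The radial factor equals `1` exactly at the wall `r² = 1` — the datum is concentrated AT the solid
boundary. [cite: LuoHou2014, §2 eq. (eqn_eat_ic)] -/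
theorem radialFactor_wall : Real.exp (-30 * (1 - (1 : ℝ) ^ 2) ^ 4) = 1 := by norm_num

/-- **`u₁⁰` is odd in `z`** ("odd at `z = 0`"). [cite: LuoHou2014, §2 (arXiv:1310.0497 p0005 L109)] -/
theorem initialU1_neg_z (r z : ℝ) : initialU1 r (-z) = -initialU1 r z := by
  simp [initialU1, mul_neg, neg_div, Real.sin_neg]

/-- **`u₁⁰` is periodic in `z` with period `L`**. [cite: LuoHou2014, §2 eq. (eqn_eat_bc_z) (arXiv:1310.0497 p0005 L86)] -/
theorem initialU1_periodic (r : ℝ) : Function.Periodic (initialU1 r) periodL := by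
  intro z
  have hL : periodL ≠ 0 := periodL_pos.ne'
  have h1 : 2 * π * (z + periodL) / periodL = 2 * π * z / periodL + 2 * π := by
    field_simp
  simp only [initialU1, h1, Real.sin_add_two_pi]

/-- **`u₁⁰` is odd about `z = L/2`**: `u₁⁰(r, L/2 + s) = −u₁⁰(r, L/2 − s)`.
[cite: LuoHou2014, §2 (arXiv:1310.0497 p0005 L109: "odd at z = 0, L/2")] -/
theorem initialU1_odd_half (r s : ℝ) :
    initialU1 r (periodL / 2 + s) = -initialU1 r (periodL / 2 - s) := by
  have hL : periodL ≠ 0 := periodL_pos.ne'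
  have h1 : 2 * π * (periodL / 2 + s) / periodL = 2 * π * s / periodL + π := by
    field_simp; ring
  have h2 : 2 * π * (periodL / 2 - s) / periodL = π - 2 * π * s / periodL := by
    field_simp
  simp only [initialU1, h1, h2, Real.sin_add_pi, Real.sin_pi_sub]
  ring

/-- **`u₁⁰` is even about `z = L/4`**: `u₁⁰(r, L/4 + s) = u₁⁰(r, L/4 − s)`.
[cite: LuoHou2014, §2 (arXiv:1310.0497 p0005 L109: "even at z = L/4, 3L/4")] -/
theorem initialU1_even_quarter (r s : ℝ) :
    initialU1 r (periodL / 4 + s) = initialU1 r (periodL / 4 - s) := by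
  have hL : periodL ≠ 0 := periodL_pos.ne'
  have h1 : 2 * π * (periodL / 4 + s) / periodL = 2 * π * s / periodL + π / 2 := by
    field_simp; ring
  have h2 : 2 * π * (periodL / 4 - s) / periodL = π / 2 - 2 * π * s / periodL := by
    field_simp; ring
  simp only [initialU1, h1, h2, Real.sin_add_pi_div_two, Real.sin_pi_div_two_sub]

/-- **`u₁⁰` is even in `r`** (pole condition `u₁,r(0,z) = 0`, eq. (eqn_eat_pc)).
[cite: LuoHou2014, §2 eq. (eqn_eat_pc) (arXiv:1310.0497 p0005 L100)] -/
theorem initialU1_neg_r (r z : ℝ) : initialU1 (-r) z = initialU1 r z := by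
  simp only [initialU1, neg_sq]

/-- **`u₁⁰` does NOT vanish at the wall**: `u₁⁰(1,z) = 100 sin(2πz/L)` — Euler with the no-flow
(slip) condition `ψ₁(1,z) = 0` only; contrast `Hou2022.initialU1_wall` (no-slip datum).
[cite: LuoHou2014, §2 eq. (eqn_eat_ic), (eqn_eat_bc_r) (arXiv:1310.0497 p0005 L82–L93)] -/
theorem initialU1_wall (z : ℝ) : initialU1 1 z = 100 * Real.sin (2 * π * z / periodL) := by
  simp [initialU1]

/-- `u₁⁰` vanishes on the planes `z = 0` (and, by oddness/periodicity, on `z ∈ (L/2)ℤ`) bounding the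
quarter cylinder. [cite: LuoHou2014, §2 (arXiv:1310.0497 p0005 L109)] -/
theorem initialU1_z_zero (r : ℝ) : initialU1 r 0 = 0 := by
  simp [initialU1]

/-- `u₁⁰` vanishes on the plane `z = L/2`. [cite: LuoHou2014, §2 (arXiv:1310.0497 p0005 L109)] -/
theorem initialU1_z_half (r : ℝ) : initialU1 r (periodL / 2) = 0 := by
  have hL : periodL ≠ 0 := periodL_pos.ne'
  have h1 : 2 * π * (periodL / 2) / periodL = π := by field_simp
  simp [initialU1, h1]

/-- **The printed identification of the wall model holds exactly at `t = 0`**: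
`(u₁⁰(1,z))² = u⁰(z) = 10⁴ sin²(2πz/L)`. [cite: LuoHou2014, §5 (arXiv:1310.0497 p0024 L33–L40)] -/
theorem initialU1_wall_sq (z : ℝ) : initialU1 1 z ^ 2 = wallModelInitialU z := by
  rw [initialU1_wall, wallModelInitialU]
  ring

/-- **Size of the datum**: `|u₁⁰(r,z)| ≤ 100` for all `(r,z)` (radial factor `≤ 1`, `|sin| ≤ 1`).
[cite: LuoHou2014, §2 eq. (eqn_eat_ic) (arXiv:1310.0497 p0005 L82)] -/
theorem abs_initialU1_le (r z : ℝ) : |initialU1 r z| ≤ 100 := by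
  have h1 := radialFactor_le_one r
  have h1' := (radialFactor_pos r).le
  have hs : |Real.sin (2 * π * z / periodL)| ≤ 1 := Real.abs_sin_le_one _
  rw [initialU1, abs_mul, abs_mul, abs_of_nonneg h1', show |(100 : ℝ)| = 100 by norm_num]
  calc 100 * Real.exp (-30 * (1 - r ^ 2) ^ 4) * |Real.sin (2 * π * z / periodL)| ≤ 100 * 1 * 1 := by
        gcongr
    _ = 100 := by norm_num

/-- The bound `100` is attained at the wall point `(r,z) = (1, L/4)` (`sin(π/2) = 1`): the datum peaks ON
the boundary. [cite: LuoHou2014, §2 eq. (eqn_eat_ic) (arXiv:1310.0497 p0005 L82)] -/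
theorem initialU1_wall_quarter : initialU1 1 (periodL / 4) = 100 := by
  have hL : periodL ≠ 0 := periodL_pos.ne'
  have h1 : 2 * π * (periodL / 4) / periodL = π / 2 := by field_simp; norm_num
  simp [initialU1, h1]

/-- `u₁⁰` is smooth on `ℝ²`. [cite: LuoHou2014, §2 (arXiv:1310.0497 p0005: smooth initial data)] -/
theorem contDiff_initialU1 : ContDiff ℝ ∞ fun q : ℝ × ℝ => initialU1 q.1 q.2 := by
  unfold initialU1
  exact (contDiff_const.mul (Real.contDiff_exp.comp
    (contDiff_const.mul ((contDiff_const.sub (contDiff_fst.pow 2)).pow 4)))).mul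
    (Real.contDiff_sin.comp ((contDiff_const.mul contDiff_snd).div_const _))

/-! ### The printed mechanism hypothesis (§4.8): `ru₁⁰` is monotone in `r` and in `z` on the quarter cylinder -/

/-- The angular velocity of the datum `u^θ(r,z) = r u₁⁰(r,z)`. [cite: LuoHou2014, §2 (u₁ = u^θ/r) (arXiv:1310.0497 p0005 L55)] -/
def initialUTheta (r z : ℝ) : ℝ := r * initialU1 r z

/-- The exponent `−30(1−r²)⁴` is monotone in `r` on `[0,1]`. [cite: LuoHou2014, §4.8 (arXiv:1310.0497 p0022 L60)] -/
theorem monotoneOn_radialExponent :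
    MonotoneOn (fun r : ℝ => -30 * (1 - r ^ 2) ^ 4) (Icc 0 1) := by
  intro a ha b hb hab
  have ha0 : 0 ≤ a := ha.1
  have hb1 : b ≤ 1 := hb.2
  have h1 : 1 - b ^ 2 ≤ 1 - a ^ 2 := by nlinarith
  have h2 : 0 ≤ 1 - b ^ 2 := by nlinarith
  have h3 : (1 - b ^ 2) ^ 4 ≤ (1 - a ^ 2) ^ 4 := by gcongr
  simp only
  linarith

/-- **`ru₁⁰` is monotonically increasing in `r ∈ [0,1]`** for each `z` in the quarter period
`0 ≤ z ≤ L/4` (where `sin(2πz/L) ≥ 0`): all three factors `r`, `e^{−30(1−r²)⁴}`, `sin(2πz/L)` are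
non-negative and the first two increase. [cite: LuoHou2014, §4.8 (arXiv:1310.0497 p0022 L60)] -/
theorem monotoneOn_initialUTheta_r {z : ℝ} (hz0 : 0 ≤ z) (hz : z ≤ periodL / 4) :
    MonotoneOn (fun r => initialUTheta r z) (Icc 0 1) := by
  have hs : 0 ≤ Real.sin (2 * π * z / periodL) := by
    apply Real.sin_nonneg_of_nonneg_of_le_pi
    · have := periodL_pos; positivity
    · rw [div_le_iff₀ periodL_pos]
      nlinarith [Real.pi_pos, periodL_pos]
  intro a ha b hb hab
  have ha0 : 0 ≤ a := ha.1
  have hexp : Real.exp (-30 * (1 - a ^ 2) ^ 4) ≤ Real.exp (-30 * (1 - b ^ 2) ^ 4) :=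
    Real.exp_le_exp.2 (monotoneOn_radialExponent ha hb hab)
  simp only [initialUTheta, initialU1]
  have : a * Real.exp (-30 * (1 - a ^ 2) ^ 4) ≤ b * Real.exp (-30 * (1 - b ^ 2) ^ 4) :=
    mul_le_mul hab hexp (radialFactor_pos a).le (ha0.trans hab)
  calc a * (100 * Real.exp (-30 * (1 - a ^ 2) ^ 4) * Real.sin (2 * π * z / periodL))
      = 100 * Real.sin (2 * π * z / periodL) * (a * Real.exp (-30 * (1 - a ^ 2) ^ 4)) := by ring
    _ ≤ 100 * Real.sin (2 * π * z / periodL) * (b * Real.exp (-30 * (1 - b ^ 2) ^ 4)) := by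
        gcongr
    _ = b * (100 * Real.exp (-30 * (1 - b ^ 2) ^ 4) * Real.sin (2 * π * z / periodL)) := by ring

/-- **`ru₁⁰` is monotonically increasing in `z ∈ [0, L/4]`** for each `r ≥ 0` (`2πz/L` runs over
`[0, π/2]`, where `sin` increases). [cite: LuoHou2014, §4.8 (arXiv:1310.0497 p0022 L60)] -/
theorem monotoneOn_initialUTheta_z {r : ℝ} (hr : 0 ≤ r) :
    MonotoneOn (fun z => initialUTheta r z) (Icc 0 (periodL / 4)) := by
  intro a ha b hb hab
  have hL := periodL_pos
  have hb' : 2 * π * b / periodL ≤ π / 2 := by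
    rw [div_le_iff₀ hL]; nlinarith [Real.pi_pos, hb.2]
  have ha' : -(π / 2) ≤ 2 * π * a / periodL := by
    have : 0 ≤ 2 * π * a / periodL := by have := ha.1; positivity
    linarith [Real.pi_pos]
  have hab' : 2 * π * a / periodL ≤ 2 * π * b / periodL := by
    gcongr
  have hsin : Real.sin (2 * π * a / periodL) ≤ Real.sin (2 * π * b / periodL) :=
    Real.strictMonoOn_sin.monotoneOn ⟨ha', hab'.trans hb'⟩ ⟨ha'.trans hab', hb'⟩ hab'
  simp only [initialUTheta, initialU1]
  have h0 : 0 ≤ r * (100 * Real.exp (-30 * (1 - r ^ 2) ^ 4)) := by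
    have := radialFactor_pos r; positivity
  calc r * (100 * Real.exp (-30 * (1 - r ^ 2) ^ 4) * Real.sin (2 * π * a / periodL))
      = r * (100 * Real.exp (-30 * (1 - r ^ 2) ^ 4)) * Real.sin (2 * π * a / periodL) := by ring
    _ ≤ r * (100 * Real.exp (-30 * (1 - r ^ 2) ^ 4)) * Real.sin (2 * π * b / periodL) :=
        mul_le_mul_of_nonneg_left hsin h0
    _ = r * (100 * Real.exp (-30 * (1 - r ^ 2) ^ 4) * Real.sin (2 * π * b / periodL)) := by ring

/-! ### The 3-D velocity datum -/

/-- The swirl profile of the datum as a scalar field on `ℝ³`: `Φ(x) = u₁⁰(|x'|, x₃)`, written through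
`|x'|² = x₀² + x₁²`. [cite: LuoHou2014, §2 eq. (eqn_eat_ic) (arXiv:1310.0497 p0005 L82)] -/
def swirlProfile (x : EuclideanSpace ℝ (Fin 3)) : ℝ :=
  100 * Real.exp (-30 * (1 - (x 0 ^ 2 + x 1 ^ 2)) ^ 4) * Real.sin (2 * π * x 2 / periodL)

/-- `Φ(x) = u₁⁰(r(x), x₃)` with `r = cylRadius`. [cite: LuoHou2014, §2 eq. (eqn_eat_ic) (arXiv:1310.0497 p0005 L82)] -/
theorem swirlProfile_eq (x : EuclideanSpace ℝ (Fin 3)) :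
    swirlProfile x = initialU1 (cylRadius x) (x 2) := by
  rw [swirlProfile, initialU1, cylRadius_sq]

/-- **The Luo–Hou velocity datum on `ℝ³`**: `u₀(x) = u^θ e_θ = r u₁⁰ e_θ = u₁⁰(r,z)·(−x₁, x₀, 0)` (pure
swirl: `ω₁⁰ = ψ₁⁰ = 0`, so `uʳ = uᶻ = 0` initially), i.e. `Φ(x) • J x` with `J x = (−x₁, x₀, 0)` (`rotGenL`).
The physical flow is its restriction to the pipe `r ≤ 1`, `z ∈ ℝ/Lℤ`.
[cite: LuoHou2014, §2 eq. (eqn_eat_ic), (eqn_eat_urz) (arXiv:1310.0497 p0005 L65–L82)] -/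
def initialVelocity (x : EuclideanSpace ℝ (Fin 3)) : EuclideanSpace ℝ (Fin 3) :=
  swirlProfile x • rotGenL x

/-- The swirl profile is an axisymmetric scalar. [cite: LuoHou2014, §2 (arXiv:1310.0497 p0005: axisymmetric flow)] -/
theorem isAxisymmetricScalar_swirlProfile : IsAxisymmetricScalar swirlProfile := by
  intro θ x
  rw [swirlProfile_eq, swirlProfile_eq, cylRadius_rotZ, rotZ_apply_two]

/-- **The datum is axisymmetric.** [cite: LuoHou2014, §2 (arXiv:1310.0497 p0005)] -/
theorem isAxisymmetric_initialVelocity : IsAxisymmetric initialVelocity :=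
  isAxisymmetric_smul_rotGenL isAxisymmetricScalar_swirlProfile

/-- The swirl profile is smooth on `ℝ³`. [cite: LuoHou2014, §2 (arXiv:1310.0497 p0005)] -/
theorem contDiff_swirlProfile : ContDiff ℝ ∞ swirlProfile := by
  have h0 : ContDiff ℝ ∞ fun x : EuclideanSpace ℝ (Fin 3) => x 0 :=
    contDiff_piLp_apply (𝕜 := ℝ) (p := 2) (i := (0 : Fin 3))
  have h1 : ContDiff ℝ ∞ fun x : EuclideanSpace ℝ (Fin 3) => x 1 :=
    contDiff_piLp_apply (𝕜 := ℝ) (p := 2) (i := (1 : Fin 3))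
  have h2 : ContDiff ℝ ∞ fun x : EuclideanSpace ℝ (Fin 3) => x 2 :=
    contDiff_piLp_apply (𝕜 := ℝ) (p := 2) (i := (2 : Fin 3))
  unfold swirlProfile
  exact (contDiff_const.mul (Real.contDiff_exp.comp
    (contDiff_const.mul ((contDiff_const.sub ((h0.pow 2).add (h1.pow 2))).pow 4)))).mul
    (Real.contDiff_sin.comp ((contDiff_const.mul h2).div_const _))

/-- **The datum is smooth** (`Φ` smooth, `J` linear). [cite: LuoHou2014, §2 (arXiv:1310.0497 p0005)] -/
theorem contDiff_initialVelocity : ContDiff ℝ ∞ initialVelocity :=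
  contDiff_swirlProfile.smul rotGenL.contDiff

/-- **The datum is divergence free** (a swirl field `Φ(r,z)·(−x₁, x₀, 0)` with axisymmetric `Φ`
is solenoidal). [cite: LuoHou2014, §2 eq. (eqn_eu_div) (arXiv:1310.0497 p0005 L46)] -/
theorem isDivFree_initialVelocity : VectorCalculus.IsDivFree initialVelocity := fun x =>
  divergence_smul_rotGenL isAxisymmetricScalar_swirlProfile
    (contDiff_swirlProfile.differentiable (by simp)).differentiableAt

/-- **The swirl of the datum**: `Γ₀(x) = r u^θ = r² u₁⁰(r,z) = (x₀² + x₁²) Φ(x)`.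
[cite: LuoHou2014, §2 (u₁ = u^θ/r) (arXiv:1310.0497 p0005 L55, L82)] -/
theorem swirl_initialVelocity (x : EuclideanSpace ℝ (Fin 3)) :
    swirl initialVelocity x = (x 0 ^ 2 + x 1 ^ 2) * swirlProfile x := by
  simp only [swirl, initialVelocity, PiLp.smul_apply, smul_eq_mul, rotGenL_apply,
    rotGen_apply_zero, rotGen_apply_one]
  ring

/-- The swirl of the datum in cylindrical terms: `Γ₀ = r² u₁⁰(r,z)`.
[cite: LuoHou2014, §2 (arXiv:1310.0497 p0005 L55, L82)] -/
theorem swirl_initialVelocity_eq (x : EuclideanSpace ℝ (Fin 3)) :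
    swirl initialVelocity x = cylRadius x ^ 2 * initialU1 (cylRadius x) (x 2) := by
  rw [swirl_initialVelocity, ← cylRadius_sq, swirlProfile_eq]

/-- **Bounded initial circulation in the pipe**: `|Γ₀(x)| ≤ 100` for `r(x) ≤ 1` — the hypothesis
`‖Γ₀‖_∞ < ∞` of the circulation maximum principle for this datum.
[cite: LuoHou2014, §2 eq. (eqn_eat_ic) (arXiv:1310.0497 p0005 L82)] -/
theorem abs_swirl_initialVelocity_le {x : EuclideanSpace ℝ (Fin 3)} (hx : cylRadius x ≤ 1) :
    |swirl initialVelocity x| ≤ 100 := by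
  have hr0 := cylRadius_nonneg x
  have hu := abs_initialU1_le (cylRadius x) (x 2)
  have hr2 : cylRadius x ^ 2 ≤ 1 := pow_le_one₀ hr0 hx
  rw [swirl_initialVelocity_eq, abs_mul, abs_of_nonneg (sq_nonneg _)]
  calc cylRadius x ^ 2 * |initialU1 (cylRadius x) (x 2)| ≤ 1 * 100 :=
        mul_le_mul hr2 hu (abs_nonneg _) zero_le_one
    _ = 100 := one_mul _

/-- **The datum satisfies the no-flow condition** `u₀ · e_r = 0` everywhere (in particular on the wall
`r = 1`): `u₀(x)·(x₀, x₁, 0) = 0` for a pure swirl field. [cite: LuoHou2014, §2 eq. (eqn_eat_bc_r), (eqn_eat_noflow) (arXiv:1310.0497 p0005 L93, L115)] -/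
theorem initialVelocity_radial (x : EuclideanSpace ℝ (Fin 3)) :
    initialVelocity x 0 * x 0 + initialVelocity x 1 * x 1 = 0 := by
  simp only [initialVelocity, PiLp.smul_apply, smul_eq_mul, rotGenL_apply, rotGen_apply_zero,
    rotGen_apply_one]
  ring

/-- The datum has no axial component: `u₀(x)₃ = 0` (`uᶻ = 2ψ₁⁰ + rψ₁⁰,r = 0`).
[cite: LuoHou2014, §2 eq. (eqn_eat_ic), (eqn_eat_urz) (arXiv:1310.0497 p0005 L65–L82)] -/
theorem initialVelocity_apply_two (x : EuclideanSpace ℝ (Fin 3)) : initialVelocity x 2 = 0 := by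
  simp [initialVelocity, rotGenL_apply, rotGen]

/-- **The datum has no poloidal part**: `ū₀ = u₀ − u₀^θ e_θ = 0` (`ω₁⁰ = ψ₁⁰ = 0`).
[cite: LuoHou2014, §2 eq. (eqn_eat_ic) (arXiv:1310.0497 p0005 L82)] -/
theorem poloidalPart_initialVelocity (x : EuclideanSpace ℝ (Fin 3)) :
    poloidalPart initialVelocity x = 0 := by
  rw [poloidalPart_eq_sub_smul_rotGen, swirl_initialVelocity, ← cylRadius_sq]
  by_cases hx : cylRadius x = 0
  · obtain ⟨h0, h1⟩ := (cylRadius_eq_zero_iff x).1 hx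
    ext i
    fin_cases i <;> simp [initialVelocity, rotGenL_apply, rotGen, h0, h1]
  · have hr : cylRadius x ^ 2 ≠ 0 := pow_ne_zero 2 hx
    rw [mul_div_cancel_left₀ _ hr, initialVelocity, rotGenL_apply, sub_self]

/-- **Dictionary with the Hou–Li / generalized-axisymmetric vocabulary**: the datum is the `n = 3`
velocity field `GeneralizedAxisymNS.toVelocity u₁⁰ ψ₁⁰` with `ψ₁⁰ = 0` (`uʳ = −rψ₁,z = 0`,
`uᶻ = 2ψ₁ + rψ₁,r = 0`, `u^θ = r u₁`) — the system Luo–Hou solve is `GeneralizedAxisymNS` at `n = 3`,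
`ν = 0`. [cite: LuoHou2014, §2 eqs. (eqn_eat), (eqn_eat_urz) (arXiv:1310.0497 p0005 L55–L70)] -/
theorem initialVelocity_eq_toVelocity (x : EuclideanSpace ℝ (Fin 3)) :
    initialVelocity x =
      GeneralizedAxisymNS.toVelocity (fun q : ℝ × ℝ => initialU1 q.1 q.2) 0 x := by
  have hz : GeneralizedAxisymNS.radialVel (0 : ℝ × ℝ → ℝ) (meridian x) = 0 := by
    simp [GeneralizedAxisymNS.radialVel, derivZ]
  have ha : GeneralizedAxisymNS.axialVel 3 (0 : ℝ × ℝ → ℝ) (meridian x) = 0 := by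
    simp [GeneralizedAxisymNS.axialVel, derivR]
  rw [GeneralizedAxisymNS.toVelocity, hz, ha, zero_smul, zero_smul, zero_add, add_zero]
  simp only [GeneralizedAxisymNS.swirlVel, meridian_apply]
  rw [← swirlProfile_eq, initialVelocity]
  by_cases hx : cylRadius x = 0
  · obtain ⟨h0, h1⟩ := (cylRadius_eq_zero_iff x).1 hx
    ext i
    fin_cases i <;> simp [rotGenL_apply, rotGen, eTheta, h0, h1, hx]
  · ext i
    fin_cases i <;> simp [rotGenL_apply, rotGen, eTheta] <;> field_simp

/-! ### The printed meridian-plane self-similar exponents and their arithmetic -/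

/-- **The one-parameter family of scaling laws (eqn_ssim_constr)** of the meridian-plane ansatz
`u₁ ∼ (t_s−t)^{γ_u} U((x̃ − q̃₀)/(t_s−t)^{γ_l})`, `ω₁ ∼ (t_s−t)^{γ_ω} Ω(·)`, `ψ₁ ∼ (t_s−t)^{γ_ψ} Ψ(·)`:
"`γ_u = −1 + γ_l/2`, `γ_ω = −1`, `γ_ψ = −1 + 2γ_l`" (dominant balance in (eqn_eat)).
[cite: LuoHou2014, §4.7 eq. (eqn_ssim_constr) (arXiv:1310.0497 p0022 L35–L43)] -/
structure MeridianExponents where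
  /-- the collapse (length) exponent `γ_l` -/
  γl : ℝ
  /-- the `u₁` amplitude exponent -/
  γu : ℝ
  /-- the `ω₁` amplitude exponent -/
  γω : ℝ
  /-- the `ψ₁` amplitude exponent -/
  γψ : ℝ
  hu : γu = -1 + γl / 2
  hω : γω = -1
  hψ : γψ = -1 + 2 * γl

namespace MeridianExponents

/-- The family is parametrised by `γ_l`. [cite: LuoHou2014, §4.7 eq. (eqn_ssim_constr)] -/
def ofCollapse (γl : ℝ) : MeridianExponents :=
  ⟨γl, -1 + γl / 2, -1, -1 + 2 * γl, rfl, rfl, rfl⟩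

/-- The printed dominant-balance system (three displayed relations before simplification) holds for
every member of the family: `γ_u − 1 = γ_u + γ_ψ − 2γ_l`, `γ_ω − 1 = γ_ω + γ_ψ − 2γ_l = 2γ_u − γ_l`,
`γ_ψ − 2γ_l = γ_ω`. [cite: LuoHou2014, §4.7 (display before (eqn_ssim_constr), arXiv:1310.0497 p0022 L35–L37)] -/
theorem dominant_balance (e : MeridianExponents) :
    e.γu - 1 = e.γu + e.γψ - 2 * e.γl ∧ e.γω - 1 = e.γω + e.γψ - 2 * e.γl ∧
      e.γω + e.γψ - 2 * e.γl = 2 * e.γu - e.γl ∧ e.γψ - 2 * e.γl = e.γω := by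
  refine ⟨?_, ?_, ?_, ?_⟩ <;> linarith [e.hu, e.hω, e.hψ]

/-- **The exponent of the radial/axial vorticity** `ωʳ = −ru₁,z`, `ωᶻ = 2u₁ + ru₁,r` under the ansatz
is `γ_u − γ_l = −(1 + γ_l/2)` (one `z`- or `r`-derivative costs `(t_s−t)^{−γ_l}`); the angular vorticity
`ω^θ = rω₁` has exponent `γ_ω = −1`. [cite: LuoHou2014, §4.7 (arXiv:1310.0497 p0022 L52–L56)] -/
theorem radialVorticityExponent (e : MeridianExponents) : e.γu - e.γl = -(1 + e.γl / 2) := by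
  linarith [e.hu]

/-- Conversely the collapse exponent is read off a fitted `‖ω‖_∞ ∼ (t_s−t)^{−γ}` by `γ_l = 2(γ − 1)`.
[cite: LuoHou2014, §4.7 (arXiv:1310.0497 p0022 L52–L56)] -/
theorem collapse_of_vorticityExponent (e : MeridianExponents) {γ : ℝ} (h : e.γu - e.γl = -γ) :
    e.γl = 2 * (γ - 1) := by
  linarith [e.hu]

end MeridianExponents

/-- **The collapse exponent read off the printed vorticity fit** `2.4568` through (eqn_ssim_constr):
`γ_l = 2(2.4568 − 1) = 2.9136`. Kernel arithmetic on printed numbers.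
[cite: LuoHou2014, §4.6 (p0018 L72) and §4.7 (eqn_ssim_constr) (arXiv:1310.0497)] -/
def collapseExponentOfVorticityFit : ℝ := 2 * (vorticityExponent - 1)

/-- `γ_l(vorticity fit) = 2.9136`. [cite: LuoHou2014, §4.6–4.7 (arXiv:1310.0497 p0018 L72, p0022 L43)] -/
theorem collapseExponentOfVorticityFit_eq : collapseExponentOfVorticityFit = 2.9136 := by
  norm_num [collapseExponentOfVorticityFit, vorticityExponent]

/-- It is the `γ_l` of the family member whose radial-vorticity exponent is the printed `−2.4568`.
[cite: LuoHou2014, §4.7 (arXiv:1310.0497 p0022 L43–L56)] -/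
theorem collapseExponentOfVorticityFit_spec :
    (MeridianExponents.ofCollapse collapseExponentOfVorticityFit).γu -
        (MeridianExponents.ofCollapse collapseExponentOfVorticityFit).γl = -vorticityExponent := by
  simp only [MeridianExponents.ofCollapse, collapseExponentOfVorticityFit]
  ring

/-- **The two printed routes to `γ_l` agree to `5·10⁻³`**: `|2.9181 − 2.9136| < 0.005` (diameter fit vs
vorticity fit). [cite: LuoHou2014, §4.6 (arXiv:1310.0497 p0018 L72, L75)] -/
theorem abs_diameterExponent_sub_lt :
    |diameterExponent - collapseExponentOfVorticityFit| < 5e-3 := by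
  rw [collapseExponentOfVorticityFit_eq, diameterExponent]
  norm_num [abs_of_nonneg]

/-- **Agreement with Chen–Hou's profile exponent** ("`c̄_l/c̄_ω ≈ −2.9205600` is very close to the one
reported by Hou–Luo", Part I §3): `|γ_CH − 2.9181| < 10⁻²` with `γ_CH = chenHou_collapseExponent`.
[cite: arXiv221007191, §3 (Exponents: ratio ≈ −2.9205600)] [cite: LuoHou2014, §4.6 (arXiv:1310.0497 p0018 L75)] -/
theorem abs_chenHou_sub_diameterExponent_lt :
    |chenHou_collapseExponent - diameterExponent| < 1e-2 := by
  rw [chenHou_collapseExponent, chenHou_cl, chenHou_cω, diameterExponent,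
    abs_of_neg (by norm_num : (-1.02942516 : ℝ) < 0)]
  rw [abs_lt]
  constructor <;> norm_num

/-- Both printed collapse exponents exceed `½` (indeed `2.9`): the collapse is far steeper than the
parabolic (Navier–Stokes) gauge `½`. [cite: LuoHou2014, §4.6–4.7 (arXiv:1310.0497 p0018 L72–L75)] -/
theorem half_lt_diameterExponent : (1 / 2 : ℝ) < diameterExponent ∧
    (1 / 2 : ℝ) < collapseExponentOfVorticityFit := by
  rw [collapseExponentOfVorticityFit_eq, diameterExponent]
  constructor <;> norm_num

/-- The printed constraint `γ_l ≥ 1` of §4.7 ("since … the velocity `u` is observed to be uniformly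
bounded, `γ_l` needs also to satisfy `γ_l ≥ 1`") holds for both fits, as does the energy constraint
`γ_l ≥ 2/5`. [cite: LuoHou2014, §4.7 (arXiv:1310.0497 p0022 L49–L50)] -/
theorem one_le_collapseExponents : (1 : ℝ) ≤ diameterExponent ∧ (1 : ℝ) ≤ collapseExponentOfVorticityFit ∧
    (2 / 5 : ℝ) ≤ diameterExponent := by
  rw [collapseExponentOfVorticityFit_eq, diameterExponent]
  refine ⟨?_, ?_, ?_⟩ <;> norm_num

/-- The amplitude exponent of `u₁` (hence of the swirl velocity `u^θ = ru₁` near the wall `r = 1`) is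
`γ_u = −1 + γ_l/2`, so it is non-negative (velocity bounded at the collapse point) iff `γ_l ≥ 2`; for the
printed fits `γ_u ≈ 0.46 > 0`, consistent with "the velocity `u` is observed to be uniformly bounded".
[cite: LuoHou2014, §4.7 (arXiv:1310.0497 p0022 L43–L50)] -/
theorem velocityExponent_nonneg_iff (e : MeridianExponents) : 0 ≤ e.γu ↔ 2 ≤ e.γl := by
  rw [e.hu]; constructor <;> intro h <;> linarith

/-- **Census hook (SELFSIM-NOGO (M8)) for the Luo–Hou scenario**: along a collapse with the printed
exponent `γ = 2.9181 > ½` the effective viscosity `ν(T−t)^{1−2γ}` of ANY constant `ν > 0` tends to `+∞`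
as `t ↑ T` — a constant viscosity is not a perturbation of this scenario (the arithmetic behind zone Z8's
stage 2 and behind Hou–Huang's / Hou's use of degenerate or solution-dependent viscosity). A statement
about printed numbers, not about Euler or Navier–Stokes. [cite: LuoHou2014, §4.6 (arXiv:1310.0497 p0018 L75)] -/
theorem tendsto_effectiveViscosity_luoHou2014_atTop {ν T : ℝ} (hν : 0 < ν) :
    Tendsto (effectiveViscosity ν diameterExponent T) (𝓝[<] T) atTop :=
  tendsto_effectiveViscosity_atTop_of_half_lt half_lt_diameterExponent.1 hν

/-- The same for the exponent read off the vorticity fit. [cite: LuoHou2014, §4.6–4.7 (arXiv:1310.0497 p0018 L72, p0022 L43)] -/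
theorem tendsto_effectiveViscosity_luoHou2014_vorticityFit_atTop {ν T : ℝ} (hν : 0 < ν) :
    Tendsto (effectiveViscosity ν collapseExponentOfVorticityFit T) (𝓝[<] T) atTop :=
  tendsto_effectiveViscosity_atTop_of_half_lt half_lt_diameterExponent.2 hν

/-- Elementary bookkeeping of the printed run numbers: `0 < t_s < L` and the amplification exceeds `1`.
[cite: LuoHou2014, abstract (arXiv:1310.0497 p0002)] -/
theorem singularityTime_pos : 0 < singularityTime ∧ singularityTime < periodL ∧
    1 < vorticityAmplification := by
  refine ⟨?_, ?_, ?_⟩ <;> norm_num [singularityTime, periodL, vorticityAmplification]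

/-! ### The MMS print (Multiscale Model. Simul. 12 (2014) 1722–1776, doi:10.1137/140966411 — the
published version of arXiv:1310.0497, held as `paper:doi-10-1137-140966411`; `p.` = printed page):
Table 17 and the leading-order corner profile system of §4.7.3, p. 1766 — two items absent from the
arXiv rendering used above (appended by ns-blowup-profile-lit g6; the MMS numbering is (2.1) = (eqn_eat),
(2.2a) = (eqn_eat_ic), (4.17) = (eqn_ssim_fit_v), (4.20) = (eqn_ssim_constr)) -/

/-- **Table 17 (p. 1766), finest mesh `2048 × 2048`: the fitted collapse exponent `γ̂_l = 2.9133`**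
(coarser meshes `1024²…1792²`: `2.7359, 2.9059, 2.9108, 2.9116`). Printed datum of a numerical fit; the
arXiv-derived `collapseExponentOfVorticityFit = 2.9136` and `diameterExponent = 2.9181` above are the two
other printed routes to the same number. [cite: LuoHou2014, §4.7.3 Table 17 p. 1766] -/
def table17GammaL : ℝ := 2.9133

/-- Table 17 (p. 1766), mesh `2048²`: `γ̂_u = 0.4604`. [cite: LuoHou2014, §4.7.3 Table 17 p. 1766] -/
def table17GammaU : ℝ := 0.4604

/-- Table 17 (p. 1766), mesh `2048²`: `γ̂_ω = −0.9972`. [cite: LuoHou2014, §4.7.3 Table 17 p. 1766] -/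
def table17GammaOmega : ℝ := -0.9972

/-- Table 17 (p. 1766), mesh `2048²`: `γ̂_ψ = 4.8322`. [cite: LuoHou2014, §4.7.3 Table 17 p. 1766] -/
def table17GammaPsi : ℝ := 4.8322

/-- Table 17's last column `γ̂_u − γ̂_l = −2.4529` is exactly the printed gradient rate `gradUExponent`
("`‖∇u‖_∞ = O(T−t)^{−2.4529}`", p. 1763): `0.4604 − 2.9133 = −2.4529`. [cite: LuoHou2014, §4.7 p. 1763 and Table 17 p. 1766] -/
theorem table17GammaU_sub_table17GammaL : table17GammaU - table17GammaL = -gradUExponent := by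
  norm_num [table17GammaU, table17GammaL, gradUExponent]

/-- **"It is clearly seen that (4.20) is approximately satisfied"** (p. 1766), quantitatively on the finest
mesh: `|γ̂_u − (−1 + γ̂_l/2)| ≤ 4·10⁻³` … [cite: LuoHou2014, §4.7.3 (4.20) and Table 17 p. 1766] -/
theorem abs_table17GammaU_sub_law_le :
    |table17GammaU - (MeridianExponents.ofCollapse table17GammaL).γu| ≤ 4e-3 := by
  rw [abs_le]; norm_num [table17GammaU, table17GammaL, MeridianExponents.ofCollapse]

/-- … `|γ̂_ω − (−1)| ≤ 3·10⁻³` … [cite: LuoHou2014, §4.7.3 (4.20) and Table 17 p. 1766] -/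
theorem abs_table17GammaOmega_sub_law_le :
    |table17GammaOmega - (MeridianExponents.ofCollapse table17GammaL).γω| ≤ 3e-3 := by
  rw [abs_le]; norm_num [table17GammaOmega, table17GammaL, MeridianExponents.ofCollapse]

/-- … and `|γ̂_ψ − (−1 + 2γ̂_l)| ≤ 6·10⁻³`. [cite: LuoHou2014, §4.7.3 (4.20) and Table 17 p. 1766] -/
theorem abs_table17GammaPsi_sub_law_le :
    |table17GammaPsi - (MeridianExponents.ofCollapse table17GammaL).γψ| ≤ 6e-3 := by
  rw [abs_le]; norm_num [table17GammaPsi, table17GammaL, MeridianExponents.ofCollapse]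

/-- **The three printed routes to `γ_l` agree**: Table 17's `2.9133`, the vorticity-fit value `2.9136`
(to `3·10⁻⁴`) and the diameter fit `2.9181` (to `5·10⁻³`).
[cite: LuoHou2014, §4.7.3 Table 17 p. 1766, Table 13 p. 1749 and §4.5 p. 1756] -/
theorem abs_table17GammaL_sub_fits_le :
    |table17GammaL - collapseExponentOfVorticityFit| ≤ 3e-4 ∧ |table17GammaL - diameterExponent| ≤ 5e-3 := by
  rw [collapseExponentOfVorticityFit_eq, table17GammaL, diameterExponent]
  constructor <;> (rw [abs_le]; norm_num)

/-- `γ̂_l > 2` on every mesh from `1280²` on, so the family member has `γ_u > 0` (the swirl velocity `u₁`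
VANISHES at the corner, `velocityExponent_nonneg_iff`), consistent with `γ̂_u = 0.4604 > 0` and with the
bounded velocity of the computation ("`γ_l ≥ 1`", p. 1766). [cite: LuoHou2014, §4.7.3 Table 17 and (4.20) p. 1766] -/
theorem two_lt_table17GammaL : (2 : ℝ) < table17GammaL ∧ 0 < (MeridianExponents.ofCollapse table17GammaL).γu ∧
    0 < table17GammaU := by
  refine ⟨?_, ?_, ?_⟩ <;> norm_num [table17GammaL, table17GammaU, MeridianExponents.ofCollapse]

/-- **Census hook on the Table-17 value**: `½ < γ̂_l = 2.9133`, so a constant viscosity has effective size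
`ν(T−t)^{1−2γ̂_l} → +∞` along the printed collapse (`tendsto_effectiveViscosity_atTop_of_half_lt`; same
reading as `tendsto_effectiveViscosity_luoHou2014_atTop` for the diameter fit). Not a statement about any
viscous computation. [cite: LuoHou2014, §4.7.3 Table 17 p. 1766] -/
theorem tendsto_effectiveViscosity_table17_atTop {ν T : ℝ} (hν : 0 < ν) :
    (1 : ℝ) / 2 < table17GammaL ∧ Tendsto (effectiveViscosity ν table17GammaL T) (𝓝[<] T) atTop :=
  have h : (1 : ℝ) / 2 < table17GammaL := by norm_num [table17GammaL]
  ⟨h, tendsto_effectiveViscosity_atTop_of_half_lt h hν⟩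

/-- Table 17's `γ̂_l` sits just below Chen–Hou's rescaled exponent for their smooth-data theorem,
`chenHou_collapseExponent = c̄_l/|c̄_ω| = 3.00649898/1.02942516 ≈ 2.9206` (Part I §3: "very close to the
one reported by Hou–Luo"); Chen–Hou–Huang 2022 §1 quote the Luo–Hou value as `λ ≈ 2.9215` and prove
`λ = 2.99870 ± 6·10⁻⁵` for the 1-D wall model (`chh2022_lambda`, `HouLuoModelSelfSimilarBlowup.lean`).
[cite: LuoHou2014, §4.7.3 Table 17 p. 1766] [cite: arXiv221007191, §3 (Exponents)] -/
theorem table17GammaL_lt_chenHou_collapseExponent : table17GammaL < chenHou_collapseExponent := by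
  rw [chenHou_collapseExponent, chenHou_cl, chenHou_cω,
    abs_of_neg (by norm_num : (-1.02942516 : ℝ) < 0), lt_div_iff₀ (by norm_num)]
  norm_num [table17GammaL]

/-! ### §4.7.3 p. 1766: the corner ansatz (4.17) at `x̃₀ = q̃₀ = (1, 0)` and the printed leading-order
profile system ("The leading-order equations resulting from the dominant balance take the form …
where `(r̃, z̃)` are the rescaled coordinates. In principle, one can solve these equations numerically and
compare the solutions to that in (4.17) … This has not been done in the current study") -/

/-- **The corner self-similar ansatz (4.17)** for one scalar unknown near `q̃₀ = (1, 0)`: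
`(T − t)^γ X((r − 1)/(T − t)^{γ_l}, z/(T − t)^{γ_l})` with amplitude exponent `γ ∈ {γ_u, γ_ω, γ_ψ}` and
the common length exponent `γ_l` (p. 1763 (4.17a)–(4.17c); p. 1766: `x̃₀ = q̃₀ = (1,0)`).
[cite: LuoHou2014, §4.7 (4.17) p. 1763 and §4.7.3 p. 1766] -/
def cornerAnsatz (γl γ T : ℝ) (X : ℝ × ℝ → ℝ) (t : ℝ) (q : ℝ × ℝ) : ℝ :=
  (T - t) ^ γ * X ((q.1 - 1) / (T - t) ^ γl, q.2 / (T - t) ^ γl)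

/-- At the corner the ansatz reads `(T − t)^γ X(0, 0)`: the amplitude exponent is the rate of the field AT
`q̃₀`. [cite: LuoHou2014, §4.7 (4.17) p. 1763] -/
theorem cornerAnsatz_corner (γl γ T : ℝ) (X : ℝ × ℝ → ℝ) (t : ℝ) :
    cornerAnsatz γl γ T X t (1, 0) = (T - t) ^ γ * X (0, 0) := by
  simp [cornerAnsatz]

/-- **The Luo–Hou leading-order corner profile system** (p. 1766) for a member `e` of the family (4.20),
in the rescaled corner coordinates `q = (r̃, z̃)`:
`−γ_u U + γ_l (r̃U_r̃ + z̃U_z̃) + (−Ψ_z̃U_r̃ + Ψ_r̃U_z̃) = 0`,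
`−γ_ω Ω + γ_l (r̃Ω_r̃ + z̃Ω_z̃) + (−Ψ_z̃Ω_r̃ + Ψ_r̃Ω_z̃) = 2UU_z̃`,
`−(Ψ_r̃r̃ + Ψ_z̃z̃) = Ω`,
imposed pointwise on a set `D ⊆ ℝ²` (no domain or boundary condition is printed); `U, Ω ∈ C¹`, `Ψ ∈ C²`;
`∂_r̃ = derivR`, `∂_z̃ = derivZ`. The planar Laplacian and the frozen transport `uʳ ≈ −ψ₁,z̃`, `uᶻ ≈ ψ₁,r̃`
reflect `r ≈ 1`. A predicate; NO solution is asserted (Luo–Hou did not compute one).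
[cite: LuoHou2014, §4.7.3 p. 1766 (leading-order equations)] -/
structure IsCornerProfileOn (D : Set (ℝ × ℝ)) (e : MeridianExponents) (U Ω Ψ : ℝ × ℝ → ℝ) : Prop where
  /-- `U ∈ C¹` -/
  contDiff_U : ContDiff ℝ 1 U
  /-- `Ω ∈ C¹` -/
  contDiff_Ω : ContDiff ℝ 1 Ω
  /-- `Ψ ∈ C²` -/
  contDiff_Ψ : ContDiff ℝ 2 Ψ
  /-- `−γ_u U + γ_l x̃·∇U + (−Ψ_z̃U_r̃ + Ψ_r̃U_z̃) = 0` -/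
  swirl_eq : ∀ q ∈ D,
    -e.γu * U q + e.γl * (q.1 * derivR U q + q.2 * derivZ U q) +
        (-derivZ Ψ q * derivR U q + derivR Ψ q * derivZ U q) = 0
  /-- `−γ_ω Ω + γ_l x̃·∇Ω + (−Ψ_z̃Ω_r̃ + Ψ_r̃Ω_z̃) = 2UU_z̃` -/
  vorticity_eq : ∀ q ∈ D,
    -e.γω * Ω q + e.γl * (q.1 * derivR Ω q + q.2 * derivZ Ω q) +
        (-derivZ Ψ q * derivR Ω q + derivR Ψ q * derivZ Ω q) = 2 * U q * derivZ U q
  /-- `−(Ψ_r̃r̃ + Ψ_z̃z̃) = Ω` -/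
  stream_eq : ∀ q ∈ D, -(derivR (derivR Ψ) q + derivZ (derivZ Ψ) q) = Ω q

/-- Non-vacuity: the zero triple solves the leading-order system on every `D` for every member of the
family. [cite: LuoHou2014, §4.7.3 p. 1766 (leading-order equations)] -/
theorem IsCornerProfileOn.zero (D : Set (ℝ × ℝ)) (e : MeridianExponents) : IsCornerProfileOn D e 0 0 0 where
  contDiff_U := contDiff_const
  contDiff_Ω := contDiff_const
  contDiff_Ψ := contDiff_const
  swirl_eq := fun q _ => by simp [derivR, derivZ]
  vorticity_eq := fun q _ => by simp [derivR, derivZ]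
  stream_eq := fun q _ => by
    have h : derivR (0 : ℝ × ℝ → ℝ) = 0 := by funext q; simp [derivR]
    have h' : derivZ (0 : ℝ × ℝ → ℝ) = 0 := by funext q; simp [derivZ]
    simp [h, h', derivR, derivZ]

/-- The system restricts to sub-domains. [cite: LuoHou2014, §4.7.3 p. 1766 (leading-order equations)] -/
theorem IsCornerProfileOn.mono {D D' : Set (ℝ × ℝ)} {e : MeridianExponents} {U Ω Ψ : ℝ × ℝ → ℝ}
    (h : IsCornerProfileOn D e U Ω Ψ) (hD : D' ⊆ D) : IsCornerProfileOn D' e U Ω Ψ where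
  contDiff_U := h.contDiff_U
  contDiff_Ω := h.contDiff_Ω
  contDiff_Ψ := h.contDiff_Ψ
  swirl_eq := fun q hq => h.swirl_eq q (hD hq)
  vorticity_eq := fun q hq => h.vorticity_eq q (hD hq)
  stream_eq := fun q hq => h.stream_eq q (hD hq)

/-- In the coefficients of the system only `γ_l` is free: `−γ_u = 1 − γ_l/2` and `−γ_ω = 1` by (4.20).
[cite: LuoHou2014, §4.7.3 (4.20) p. 1766] -/
theorem IsCornerProfileOn.coefficients (e : MeridianExponents) : -e.γu = 1 - e.γl / 2 ∧ -e.γω = 1 := by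
  constructor <;> linarith [e.hu, e.hω]

end LuoHou2014

end Literature.Analysis.FluidPDE

end
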